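import Literature.Analysis.FluidPDE.TorusClassicalNSModeDuhamel
import HarnessLib

/-!
# The Duhamel formula for the (forced) linearised Navier–Stokes equation tested against a Stokes
# eigenmode

Analysis/FluidPDE support file (theorem-only); the linear twin of `TorusClassicalNSModeDuhamel.lean`.
For a jointly smooth divergence-free background `u` on `[a, b] × T^d` and a smooth solution `(w, q)` of the
forced linearised system
`∂ₜw + (u·∇)w + (w·∇)u = νΔw − ∇q + g`,  `div w = 0`
(the hypotheses are the unbundled 5-tuple used throughout `TorusLinearisedNS*.lean`), tested against a
smooth divergence-free eigenfield `φ` of the Laplacian, `Δφ = -λφ`: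

* `linearisedNSForced_integral_inner_timeDerivWithin_eq` — the tested equation
  `∫⟪∂ₜw, φ⟫ = ν∫⟪w, Δφ⟫ + ∫⟪w, (u·∇)φ⟫ − ∫⟪(w·∇)u, φ⟫ + ∫⟪g, φ⟫`
  (antisymmetry of `(u·∇)` for divergence-free `u`, Green's symmetry of `Δ`, `∫⟪∇q, φ⟫ = 0`);
* `linearisedNSForced_hasDerivWithinAt_integral_inner_of_eigenmode` — the mode ODE `c' = -νλ c + γ` for
  `c(s) = ∫⟪w(s), φ⟫` with the continuous source
  `γ(s) = ∫⟪w, (u·∇)φ⟫ − ∫⟪(w·∇)u, φ⟫ + ∫⟪g, φ⟫`;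
* `linearisedNSForced_integral_inner_eq_exp_mul_add_integral` — the **Duhamel formula**
  `c(t) = e^{-νλ(t-a)} c(a) + ∫ₐᵗ e^{-νλ(t-s)} γ(s) ds`.

This is the coefficientwise form of the mild linearised equation
`w(t) = e^{-ν(t-a)A} w(a) + ∫ₐᵗ e^{-ν(t-s)A} P(g − (u·∇)w − (w·∇)u) ds` — the identification of the classical
derivative cocycle of the Navier–Stokes semiflow with the mild linearised flow of the smooth model
(Constantin–Foias 1988, Ch. 14, (14.2)–(14.4)).

## Mathlib search

Mathlib has no Navier–Stokes notions.  Used: the tree's scalar variation-of-constants lemma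
`eq_exp_mul_add_integral_of_hasDerivWithinAt` (`TorusClassicalNSModeDuhamel.lean`), the torus calculus
`integral_inner_convect_eq_neg`, `integral_inner_laplacian_comm`, `integral_inner_gradient_eq_zero_of_isDivFree`,
and `IsSmoothSpaceTimeOn.hasDerivWithinAt_integral_inner_const`.

## References

* P. Constantin, C. Foias, *Navier–Stokes Equations* (Chicago 1988), Ch. 14, (14.2)–(14.4).
  [ConstantinFoiasNSE1988]
-/

noncomputable section

open MeasureTheory Set Filter Function
open scoped InnerProductSpace RealInnerProductSpace Topology

namespace Literature.Analysis.FluidPDE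

open Literature.Analysis.FunctionSpaces Literature.Analysis.FunctionSpaces.Torus

variable {d : Type*} [Fintype d] [DecidableEq d]

variable {a b ν : ℝ} {u w g : ℝ → UnitAddTorus d → EuclideanSpace ℝ d} {q : ℝ → UnitAddTorus d → ℝ}

/-- **The forced linearised equation tested against a smooth divergence-free field.**  For a jointly
smooth divergence-free background `u` on `[a, b] × T^d` (`a < b`), a smooth solution `(w, q)` of
`∂ₜw + (u·∇)w + (w·∇)u = νΔw − ∇q + g` and a smooth divergence-free test field `φ`, at `t ∈ [a, b]`:
`∫⟪∂ₜw, φ⟫ = ν∫⟪w, Δφ⟫ + ∫⟪w, (u·∇)φ⟫ − ∫⟪(w·∇)u, φ⟫ + ∫⟪g, φ⟫`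
(`∫⟪(u·∇)w, φ⟫ = -∫⟪w, (u·∇)φ⟫` for `div u = 0`, `∫⟪Δw, φ⟫ = ∫⟪w, Δφ⟫`, `∫⟪∇q, φ⟫ = 0` for `div φ = 0`).
[cite: ConstantinFoiasNSE1988, Ch. 14 (14.2)–(14.4)] -/
theorem linearisedNSForced_integral_inner_timeDerivWithin_eq (hab : a < b)
    (hu : IsSmoothSpaceTimeOn (Icc a b) u) (hudiv : ∀ t ∈ Icc a b, IsDivFree (u t))
    (hw : IsSmoothSpaceTimeOn (Icc a b) w) (hq : IsSmoothSpaceTimeOn (Icc a b) q)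
    (hg : IsSmoothSpaceTimeOn (Icc a b) g)
    (hlin : ∀ t ∈ Icc a b, ∀ x, timeDerivWithin (Icc a b) w t x + convect (u t) (w t) x + convect (w t) (u t) x =
      ν • laplacian (w t) x - gradient (q t) x + g t x)
    {φ : UnitAddTorus d → EuclideanSpace ℝ d} (hφ : IsSmooth φ) (hφdiv : IsDivFree φ)
    {t : ℝ} (ht : t ∈ Icc a b) :
    ∫ x, ⟪timeDerivWithin (Icc a b) w t x, φ x⟫ =
      ν * (∫ x, ⟪w t x, laplacian φ x⟫) + (∫ x, ⟪w t x, convect (u t) φ x⟫) -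
        (∫ x, ⟪convect (w t) (u t) x, φ x⟫) + ∫ x, ⟪g t x, φ x⟫ := by
  have hU : UniqueDiffOn ℝ (Icc a b) := uniqueDiffOn_Icc hab
  have hut : IsSmooth (u t) := hu.isSmooth_slice ht
  have hwt : IsSmooth (w t) := hw.isSmooth_slice ht
  have hqt : IsSmooth (q t) := hq.isSmooth_slice ht
  have hgt : IsSmooth (g t) := hg.isSmooth_slice ht
  have heq : ∀ x, timeDerivWithin (Icc a b) w t x =
      ν • laplacian (w t) x - gradient (q t) x + g t x - convect (u t) (w t) x - convect (w t) (u t) x := by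
    intro x
    rw [← hlin t ht x]
    abel
  have iC1 : Integrable (fun x => ⟪convect (u t) (w t) x, φ x⟫) volume := ((hut.convect hwt).inner hφ).integrable
  have iC2 : Integrable (fun x => ⟪convect (w t) (u t) x, φ x⟫) volume := ((hwt.convect hut).inner hφ).integrable
  have iL : Integrable (fun x => ⟪ν • laplacian (w t) x, φ x⟫) volume := ((hwt.laplacian.smul ν).inner hφ).integrable
  have iG : Integrable (fun x => ⟪gradient (q t) x, φ x⟫) volume := (hqt.gradient.inner hφ).integrable
  have iF : Integrable (fun x => ⟪g t x, φ x⟫) volume := (hgt.inner hφ).integrable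
  have hL : ∫ x, ⟪ν • laplacian (w t) x, φ x⟫ = ν * ∫ x, ⟪w t x, laplacian φ x⟫ := by
    have hcomm : (fun x => ⟪ν • laplacian (w t) x, φ x⟫) = fun x => ν * ⟪laplacian (w t) x, φ x⟫ :=
      funext fun x => by rw [real_inner_smul_left]
    rw [hcomm, integral_const_mul, integral_inner_laplacian_comm hwt hφ]
  have hGr : ∫ x, ⟪gradient (q t) x, φ x⟫ = 0 := integral_inner_gradient_eq_zero_of_isDivFree hφ hqt hφdiv
  have hC : ∫ x, ⟪convect (u t) (w t) x, φ x⟫ = -∫ x, ⟪w t x, convect (u t) φ x⟫ :=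
    integral_inner_convect_eq_neg hut (hudiv t ht) hwt hφ
  have i1 : Integrable (fun x => ⟪ν • laplacian (w t) x, φ x⟫ - ⟪gradient (q t) x, φ x⟫) volume := iL.sub iG
  have i2 : Integrable (fun x => ⟪ν • laplacian (w t) x, φ x⟫ - ⟪gradient (q t) x, φ x⟫ + ⟪g t x, φ x⟫) volume :=
    i1.add iF
  have i3 : Integrable (fun x => ⟪ν • laplacian (w t) x, φ x⟫ - ⟪gradient (q t) x, φ x⟫ + ⟪g t x, φ x⟫ -
      ⟪convect (u t) (w t) x, φ x⟫) volume := i2.sub iC1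
  calc ∫ x, ⟪timeDerivWithin (Icc a b) w t x, φ x⟫
      = ∫ x, (⟪ν • laplacian (w t) x, φ x⟫ - ⟪gradient (q t) x, φ x⟫ + ⟪g t x, φ x⟫ -
          ⟪convect (u t) (w t) x, φ x⟫ - ⟪convect (w t) (u t) x, φ x⟫) := by
        refine integral_congr_ae (ae_of_all _ fun x => ?_)
        show ⟪timeDerivWithin (Icc a b) w t x, φ x⟫ = _
        rw [heq x]
        simp only [inner_add_left, inner_sub_left]
    _ = (∫ x, ⟪ν • laplacian (w t) x, φ x⟫) - (∫ x, ⟪gradient (q t) x, φ x⟫) + (∫ x, ⟪g t x, φ x⟫) -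
          (∫ x, ⟪convect (u t) (w t) x, φ x⟫) - ∫ x, ⟪convect (w t) (u t) x, φ x⟫ := by
        rw [integral_sub i3 iC2, integral_sub i2 iC1, integral_add i1 iF, integral_sub iL iG]
    _ = _ := by
        rw [hL, hGr, hC]
        ring

/-- **The source of the linearised mode ODE is continuous in time** on `[a, b]` (`a < b`): space integrals
of jointly smooth fields depend continuously on time. [folklore] -/
theorem linearisedNSForced_continuousOn_modeSource (hab : a < b)
    (hu : IsSmoothSpaceTimeOn (Icc a b) u) (hw : IsSmoothSpaceTimeOn (Icc a b) w) (hg : IsSmoothSpaceTimeOn (Icc a b) g)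
    {φ : UnitAddTorus d → EuclideanSpace ℝ d} (hφ : IsSmooth φ) :
    ContinuousOn (fun s => (∫ x, ⟪w s x, convect (u s) φ x⟫) - (∫ x, ⟪convect (w s) (u s) x, φ x⟫) +
      ∫ x, ⟪g s x, φ x⟫) (Icc a b) := by
  have hU : UniqueDiffOn ℝ (Icc a b) := uniqueDiffOn_Icc hab
  have hφ' : IsSmoothSpaceTimeOn (Icc a b) (fun _ : ℝ => φ) := isSmoothSpaceTimeOn_const hφ _
  have h1 : IsSmoothSpaceTimeOn (Icc a b) (fun s x => ⟪w s x, convect (u s) φ x⟫) := hw.inner (hu.convect hφ' hU)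
  have h2 : IsSmoothSpaceTimeOn (Icc a b) (fun s x => ⟪convect (w s) (u s) x, φ x⟫) := (hw.convect hu hU).inner hφ'
  have h3 : IsSmoothSpaceTimeOn (Icc a b) (fun s x => ⟪g s x, φ x⟫) := hg.inner hφ'
  exact ((h1.continuousOn_integral (convex_Icc a b)).sub (h2.continuousOn_integral (convex_Icc a b))).add
    (h3.continuousOn_integral (convex_Icc a b))

/-- **The linearised mode ODE**: with a smooth divergence-free eigenfield `Δφ = -λφ`, the coefficient
`c(s) = ∫⟪w(s), φ⟫` of a smooth solution of the forced linearised system satisfies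
`c' = -νλ c + (∫⟪w, (u·∇)φ⟫ − ∫⟪(w·∇)u, φ⟫ + ∫⟪g, φ⟫)` within `[a, b]`. [cite: ConstantinFoiasNSE1988, Ch. 14 (14.2)–(14.4)] -/
theorem linearisedNSForced_hasDerivWithinAt_integral_inner_of_eigenmode (hab : a < b)
    (hu : IsSmoothSpaceTimeOn (Icc a b) u) (hudiv : ∀ t ∈ Icc a b, IsDivFree (u t))
    (hw : IsSmoothSpaceTimeOn (Icc a b) w) (hq : IsSmoothSpaceTimeOn (Icc a b) q)
    (hg : IsSmoothSpaceTimeOn (Icc a b) g)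
    (hlin : ∀ t ∈ Icc a b, ∀ x, timeDerivWithin (Icc a b) w t x + convect (u t) (w t) x + convect (w t) (u t) x =
      ν • laplacian (w t) x - gradient (q t) x + g t x)
    {φ : UnitAddTorus d → EuclideanSpace ℝ d} (hφ : IsSmooth φ) (hφdiv : IsDivFree φ)
    {lam : ℝ} (heig : ∀ x, laplacian φ x = -(lam • φ x)) {s : ℝ} (hs : s ∈ Icc a b) :
    HasDerivWithinAt (fun r => ∫ x, ⟪w r x, φ x⟫)
      (-(ν * lam * ∫ x, ⟪w s x, φ x⟫) + ((∫ x, ⟪w s x, convect (u s) φ x⟫) -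
        (∫ x, ⟪convect (w s) (u s) x, φ x⟫) + ∫ x, ⟪g s x, φ x⟫)) (Icc a b) s := by
  have hU : UniqueDiffOn ℝ (Icc a b) := uniqueDiffOn_Icc hab
  have hD := hw.hasDerivWithinAt_integral_inner_const (convex_Icc a b) hU hφ hs
  rw [linearisedNSForced_integral_inner_timeDerivWithin_eq hab hu hudiv hw hq hg hlin hφ hφdiv hs] at hD
  have hL : ∫ x, ⟪w s x, laplacian φ x⟫ = -(lam * ∫ x, ⟪w s x, φ x⟫) := by
    have hpt : (fun x => ⟪w s x, laplacian φ x⟫) = fun x => -lam * ⟪w s x, φ x⟫ := by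
      funext x
      rw [heig x, inner_neg_right, real_inner_smul_right]
      ring
    rw [hpt, integral_const_mul]
    ring
  convert hD using 1
  rw [hL]
  ring

/-- **Duhamel formula for the mode coefficients of the forced linearised Navier–Stokes equation.**  For a
jointly smooth divergence-free background `u` on `[a, b] × T^d`, a smooth solution `(w, q)` of
`∂ₜw + (u·∇)w + (w·∇)u = νΔw − ∇q + g`, and a smooth divergence-free eigenfield `Δφ = -λφ`, for every
`t ∈ [a, b]`:
`∫⟪w(t), φ⟫ = e^{-νλ(t-a)} ∫⟪w(a), φ⟫ + ∫ₐᵗ e^{-νλ(t-s)} (∫⟪w, (u·∇)φ⟫ − ∫⟪(w·∇)u, φ⟫ + ∫⟪g, φ⟫)(s) ds` —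
the coefficientwise form of the mild linearised equation
`w(t) = e^{-ν(t-a)A}w(a) + ∫ₐᵗ e^{-ν(t-s)A} P(g − (u·∇)w − (w·∇)u) ds` (Constantin–Foias 1988, Ch. 14).
[cite: ConstantinFoiasNSE1988, Ch. 14 (14.2)–(14.4)] -/
theorem linearisedNSForced_integral_inner_eq_exp_mul_add_integral
    (hu : IsSmoothSpaceTimeOn (Icc a b) u) (hudiv : ∀ t ∈ Icc a b, IsDivFree (u t))
    (hw : IsSmoothSpaceTimeOn (Icc a b) w) (hq : IsSmoothSpaceTimeOn (Icc a b) q)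
    (hg : IsSmoothSpaceTimeOn (Icc a b) g)
    (hlin : ∀ t ∈ Icc a b, ∀ x, timeDerivWithin (Icc a b) w t x + convect (u t) (w t) x + convect (w t) (u t) x =
      ν • laplacian (w t) x - gradient (q t) x + g t x)
    {φ : UnitAddTorus d → EuclideanSpace ℝ d} (hφ : IsSmooth φ) (hφdiv : IsDivFree φ)
    {lam : ℝ} (heig : ∀ x, laplacian φ x = -(lam • φ x)) {t : ℝ} (ht : t ∈ Icc a b) :
    ∫ x, ⟪w t x, φ x⟫ =
      Real.exp (-(ν * lam * (t - a))) * (∫ x, ⟪w a x, φ x⟫) +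
        ∫ s in a..t, Real.exp (-(ν * lam * (t - s))) *
          ((∫ x, ⟪w s x, convect (u s) φ x⟫) - (∫ x, ⟪convect (w s) (u s) x, φ x⟫) + ∫ x, ⟪g s x, φ x⟫) := by
  rcases eq_or_lt_of_le (ht.1.trans ht.2) with hab | hab
  · subst hab
    have hta : t = a := le_antisymm ht.2 ht.1
    subst hta
    simp
  · exact eq_exp_mul_add_integral_of_hasDerivWithinAt (μ := ν * lam)
      (fun s hs => linearisedNSForced_hasDerivWithinAt_integral_inner_of_eigenmode hab hu hudiv hw hq hg hlin hφ
        hφdiv heig hs)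
      (linearisedNSForced_continuousOn_modeSource hab hu hw hg hφ) ht

end Literature.Analysis.FluidPDE

end
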